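import Summits.NavierStokesRegularity.NavierStokesRegularity.Theorems.AdaptedFrequencyAdaptedKernelExistsPackagingEnvelope
import Summits.NavierStokesRegularity.NavierStokesRegularity.Theorems.AdaptedFrequencyAdaptedKernelExistsPrekernelDecayBox
import Literature.Analysis.UnboundedOperators.HeatIteratedDerivBounds
import Literature.Analysis.UnboundedOperators.HeatDuhamelSliceRegularity
import Literature.Analysis.FluidPDE.SpaceTimeCalculus

/-!
# Crux `AdaptedFrequencyConverges` (stmt-NavierStokesRegularity-10493), line
  `cloud-frame-effective-tsai`: the BACKWARD CALORIC EXTENSION for STUB `stub_blockSolver`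

Helper file (lands `--supports stmt-NavierStokesRegularity-10493`) for the registered stub
`stub_blockSolver` (classical solution of the adjoint equation `∂ₜW + b·∇W + νΔW = 0` on a time
block with smooth compactly supported nonnegative terminal data `f`).  The solution is built as
`W = F + w` with `F` the backward caloric extension of `f`,

  `F(t, x) = e^{ν(T−t)Δ} f (x) = heatExtension f (ν (T − t)) x`  (`t < T`),

and `w` an `L²` corrector.  This file records the elementary facts about `F` (everything from
the tree's heat-kernel library `Literature/Analysis/UnboundedOperators/HeatKernel*.lean`):

* `caloric_data_bounds`, `caloric_data_le_heatKernel`: `f`, `Df`, `D²f` are bounded and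
  `|f| ≤ C_f G₁` (`G_σ = heatKernel σ` the Gauss–Weierstrass kernel);
* `caloric_isSmoothSpaceTimeOn`: `F` is jointly smooth on `(−∞, T) × ℝ³`;
* `caloric_hasDerivAt_time`: `∂ₜF = −νΔF` (the backward heat equation);
* `caloric_fderiv_eq`, `caloric_norm_fderiv_le`: `D(F t) = e^{ν(T−t)Δ}(Df)`, `‖D(F t)‖ ≤ C₁`;
* `caloric_nonneg`, `caloric_abs_le`, `caloric_le_heatKernel`: `0 ≤ F ≤ C₀` and the Gaussian
  domination `F(t, x) ≤ C_f G_{ν(T−t)+1}(x)` (semigroup law), whence the uniform smallness of `F`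
  at spatial infinity on bounded time ranges (`caloric_small_far`);
* `caloric_abs_sub_data_le`: `|F(t, x) − f(x)| ≤ 3 C₂ ν (T − t)` (terminal attainment).
-/

noncomputable section

open MeasureTheory Set Filter Topology Metric Function Real
open scoped Laplacian ContDiff
open Literature.Analysis.FluidPDE Literature.Analysis.UnboundedOperators
open Summit.NavierStokesRegularity.NavierStokesRegularity.Theorems.AdaptedKernelExists.NashEntropyLastBlock

namespace Summit.NavierStokesRegularity.NavierStokesRegularity.Theorems.AdaptedFrequencyConverges.CloudFrameEffectiveTsai

variable {ν T : ℝ} {f : EuclideanSpace ℝ (Fin 3) → ℝ} {F : ℝ → EuclideanSpace ℝ (Fin 3) → ℝ}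

/-! ### The data -/

/-- A `C²` compactly supported function and its first two derivatives are bounded. -/
theorem caloric_data_bounds (hf : ContDiff ℝ 2 f) (hfc : HasCompactSupport f) :
    ∃ C₀ C₁ C₂ : ℝ, (∀ z, ‖f z‖ ≤ C₀) ∧ (∀ z, ‖fderiv ℝ f z‖ ≤ C₁) ∧
      (∀ z, ‖iteratedFDeriv ℝ 2 f z‖ ≤ C₂) := by
  obtain ⟨C₀, hC₀⟩ := hf.continuous.bounded_above_of_compact_support hfc
  obtain ⟨C₁, hC₁⟩ := (hf.continuous_fderiv (by norm_num)).bounded_above_of_compact_support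
    (hfc.fderiv (𝕜 := ℝ))
  obtain ⟨C₂, hC₂⟩ := (hf.continuous_iteratedFDeriv le_rfl).bounded_above_of_compact_support
    (hfc.iteratedFDeriv 2)
  exact ⟨C₀, C₁, C₂, hC₀, hC₁, hC₂⟩

/-- **Gaussian domination of compactly supported bounded data**: `‖g‖ ≤ C_g G₁`
(`g` vanishes off a ball `B̄(0, R)`, on which `G₁ ≥ (4π)^{-3/2} e^{−R²/4}`). -/
theorem caloric_data_le_heatKernel {G : Type*} [NormedAddCommGroup G]
    {g : EuclideanSpace ℝ (Fin 3) → G} (hgc : HasCompactSupport g) {C₀ : ℝ}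
    (hC₀ : ∀ z, ‖g z‖ ≤ C₀) :
    ∃ Cg : ℝ, 0 ≤ Cg ∧ ∀ z, ‖g z‖ ≤ Cg * heatKernel 1 z := by
  obtain ⟨R, hR⟩ := hgc.isCompact.isBounded.subset_closedBall 0
  have hC₀0 : 0 ≤ C₀ := (norm_nonneg _).trans (hC₀ 0)
  set K : ℝ := (4 * π * (1:ℝ)) ^ (-(Module.finrank ℝ (EuclideanSpace ℝ (Fin 3)) : ℝ) / 2) *
    Real.exp (-R ^ 2 / (4 * 1)) with hK
  have hK0 : 0 < K := by rw [hK]; positivity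
  refine ⟨C₀ / K, by positivity, fun z => ?_⟩
  by_cases hz : z ∈ tsupport g
  · have hzR : ‖z‖ ≤ R := mem_closedBall_zero_iff.1 (hR hz)
    have hGK : K ≤ heatKernel 1 z := by
      rw [hK]
      unfold heatKernel
      refine mul_le_mul_of_nonneg_left (Real.exp_le_exp.2 ?_) (by positivity)
      rw [neg_div, neg_div, neg_le_neg_iff]
      exact div_le_div_of_nonneg_right (pow_le_pow_left₀ (norm_nonneg _) hzR 2) (by norm_num)
    calc ‖g z‖ ≤ C₀ := hC₀ z
      _ = C₀ / K * K := by field_simp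
      _ ≤ C₀ / K * heatKernel 1 z := mul_le_mul_of_nonneg_left hGK (by positivity)
  · rw [image_eq_zero_of_notMem_tsupport hz, norm_zero]
    exact mul_nonneg (by positivity) (heatKernel_pos one_pos z).le

/-- **Gaussian domination propagates along the heat flow**: if `‖g‖ ≤ C_g G₁` then
`‖e^{σΔ}g(x)‖ ≤ C_g G_{σ+1}(x)` for `0 < σ` (positivity of the kernel and the semigroup law
`G_σ ⋆ G₁ = G_{σ+1}`). -/
theorem caloric_norm_heatExtension_le_heatKernel {G : Type*} [NormedAddCommGroup G]
    [NormedSpace ℝ G] {g : EuclideanSpace ℝ (Fin 3) → G} {Cg : ℝ}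
    (hCg : ∀ z, ‖g z‖ ≤ Cg * heatKernel 1 z) {σ : ℝ} (hσ : 0 < σ) (x : EuclideanSpace ℝ (Fin 3)) :
    ‖heatExtension g σ x‖ ≤ Cg * heatKernel (σ + 1) x := by
  rw [heatExtension_apply]
  have hG1 : Integrable fun y : EuclideanSpace ℝ (Fin 3) => heatKernel 1 (x - y) :=
    (integrable_heatKernel_holds one_pos).comp_sub_left x
  have hI2 : Integrable fun y : EuclideanSpace ℝ (Fin 3) =>
      heatKernel σ y * (Cg * heatKernel 1 (x - y)) := by
    have h := (hG1.const_mul Cg).bdd_mul (c := (4 * π * σ) ^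
      (-(Module.finrank ℝ (EuclideanSpace ℝ (Fin 3)) : ℝ) / 2))
      (continuous_heatKernel _).aestronglyMeasurable
      (Eventually.of_forall fun y => by
        rw [Real.norm_of_nonneg (heatKernel_pos hσ y).le]; exact heatKernel_le hσ y)
    exact h
  calc ‖∫ y, heatKernel σ y • g (x - y)‖
      ≤ ∫ y, heatKernel σ y * (Cg * heatKernel 1 (x - y)) := by
        refine norm_integral_le_of_norm_le hI2 (Eventually.of_forall fun y => ?_)
        rw [norm_smul, Real.norm_of_nonneg (heatKernel_pos hσ y).le]
        exact mul_le_mul_of_nonneg_left (hCg _) (heatKernel_pos hσ y).le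
    _ = Cg * ∫ y, heatKernel σ (y - 0) * heatKernel 1 (x - y) := by
        rw [← integral_const_mul]
        refine integral_congr_ae (Eventually.of_forall fun y => ?_)
        simp only [sub_zero]; ring
    _ = Cg * heatKernel (σ + 1) x := by
        rw [kernelPackaging_integral_heatKernel_mul_heatKernel hσ one_pos x 0, sub_zero]

/-! ### Smoothness and the backward heat equation -/

/-- **Joint smoothness**: the backward caloric extension `F(t, x) = e^{ν(T−t)Δ}f(x)` of
compactly supported continuous data is jointly smooth on `(−∞, T) × ℝ³`. -/
theorem caloric_isSmoothSpaceTimeOn (hν : 0 < ν) (hf : Continuous f) (hfc : HasCompactSupport f)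
    (hF : F = fun t x => heatExtension f (ν * (T - t)) x) :
    IsSmoothSpaceTimeOn (Iio T) F := by
  have h1 : ContDiff ℝ ∞ (fun p : ℝ × EuclideanSpace ℝ (Fin 3) => (ν * (T - p.1), p.2)) := by
    fun_prop
  have h2 : MapsTo (fun p : ℝ × EuclideanSpace ℝ (Fin 3) => (ν * (T - p.1), p.2)) (Iio T ×ˢ univ)
      (Ioi (0 : ℝ) ×ˢ univ) := by
    rintro ⟨t, x⟩ ⟨ht, -⟩
    exact ⟨mul_pos hν (sub_pos.2 ht), mem_univ _⟩
  have h3 := (contDiffOn_uncurry_heatExtension (hf.locallyIntegrable) hfc (m := ⊤)).comp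
    h1.contDiffOn h2
  rw [hF]
  exact h3

/-- Every time slice `F t` is `Cⁿ` (also at the junk times `t ≥ T`: a convolution of a
continuous kernel with `Cⁿ` compactly supported data). -/
theorem caloric_contDiff_slice {n : ℕ∞} (hf : ContDiff ℝ n f) (hfc : HasCompactSupport f)
    (hF : F = fun t x => heatExtension f (ν * (T - t)) x) (t : ℝ) : ContDiff ℝ n (F t) := by
  rw [hF]
  exact contDiff_heatExtension_of_hasCompactSupport hf hfc _

/-- The slices `F t` satisfy `Δ(F t) = e^{ν(T−t)Δ}(Δf)`. -/
theorem caloric_laplacian_eq (hf : ContDiff ℝ 2 f) (hfc : HasCompactSupport f)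
    (hF : F = fun t x => heatExtension f (ν * (T - t)) x) (t : ℝ) (x : EuclideanSpace ℝ (Fin 3)) :
    (Δ (F t)) x = heatExtension (Δ f) (ν * (T - t)) x := by
  rw [hF]
  exact laplacian_heatExtension_of_hasCompactSupport hf hfc _ x

/-- **The backward heat equation** `∂ₜF = −νΔF` on `t < T` (two-sided derivative). -/
theorem caloric_hasDerivAt_time (hν : 0 < ν) (hf : ContDiff ℝ 2 f) (hfc : HasCompactSupport f)
    (hF : F = fun t x => heatExtension f (ν * (T - t)) x) {t : ℝ} (ht : t < T)
    (x : EuclideanSpace ℝ (Fin 3)) :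
    HasDerivAt (fun s => F s x) (-(ν * (Δ (F t)) x)) t := by
  have hσ : 0 < ν * (T - t) := mul_pos hν (sub_pos.2 ht)
  have hin : HasDerivAt (fun s : ℝ => ν * (T - s)) (ν * (0 - 1)) t :=
    ((hasDerivAt_const t T).sub (hasDerivAt_id t)).const_mul ν
  have h1 := (hasDerivAt_heatExtension_time_of_hasCompactSupport hf hfc hσ x).comp t hin
  rw [caloric_laplacian_eq hf hfc hF t x, hF]
  refine h1.congr_deriv ?_
  ring

/-! ### Gradient -/

/-- **Derivatives fall on the data**: `D(F t) = e^{ν(T−t)Δ}(Df)`. -/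
theorem caloric_fderiv_eq (hf : ContDiff ℝ 1 f) (hfc : HasCompactSupport f)
    (hF : F = fun t x => heatExtension f (ν * (T - t)) x) (t : ℝ) (x : EuclideanSpace ℝ (Fin 3)) :
    fderiv ℝ (F t) x = heatExtension (fderiv ℝ f) (ν * (T - t)) x := by
  rw [hF]
  exact fderiv_heatExtension_of_hasCompactSupport hf hfc _ x

/-- **Gradient bound** `‖D(F t)(x)‖ ≤ C₁` for `t < T` (maximum principle on `Df`). -/
theorem caloric_norm_fderiv_le (hν : 0 < ν) (hf : ContDiff ℝ 1 f) (hfc : HasCompactSupport f)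
    (hF : F = fun t x => heatExtension f (ν * (T - t)) x) {C₁ : ℝ} (hC₁ : ∀ z, ‖fderiv ℝ f z‖ ≤ C₁)
    {t : ℝ} (ht : t < T) (x : EuclideanSpace ℝ (Fin 3)) :
    ‖fderiv ℝ (F t) x‖ ≤ C₁ := by
  rw [caloric_fderiv_eq hf hfc hF t x]
  exact norm_heatExtension_le hC₁ (mul_pos hν (sub_pos.2 ht)) x

/-! ### Size -/

/-- **Sup bound** `|F(t, x)| ≤ C₀` for `t < T`. -/
theorem caloric_abs_le (hν : 0 < ν) (hF : F = fun t x => heatExtension f (ν * (T - t)) x)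
    {C₀ : ℝ} (hC₀ : ∀ z, ‖f z‖ ≤ C₀) {t : ℝ} (ht : t < T) (x : EuclideanSpace ℝ (Fin 3)) :
    |F t x| ≤ C₀ := by
  rw [hF, ← Real.norm_eq_abs]
  exact norm_heatExtension_le hC₀ (mul_pos hν (sub_pos.2 ht)) x

/-- **Nonnegativity**: `0 ≤ F(t, x)` for `t < T` when `f ≥ 0`. -/
theorem caloric_nonneg (hν : 0 < ν) (hF : F = fun t x => heatExtension f (ν * (T - t)) x)
    (hf0 : ∀ z, 0 ≤ f z) {t : ℝ} (ht : t < T) (x : EuclideanSpace ℝ (Fin 3)) : 0 ≤ F t x := by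
  rw [hF]
  show 0 ≤ heatExtension f (ν * (T - t)) x
  rw [heatExtension_apply]
  exact integral_nonneg fun y => smul_nonneg (heatKernel_pos (mul_pos hν (sub_pos.2 ht)) y).le
    (hf0 _)

/-- **Gaussian domination**: if `|f| ≤ C_f G₁` then `F(t, x) ≤ C_f G_{ν(T−t)+1}(x)` for `t < T`
(positivity of the kernel and the semigroup law `G_σ ⋆ G₁ = G_{σ+1}`). -/
theorem caloric_le_heatKernel (hν : 0 < ν)
    (hF : F = fun t x => heatExtension f (ν * (T - t)) x) {Cf : ℝ}
    (hCf : ∀ z, ‖f z‖ ≤ Cf * heatKernel 1 z) {t : ℝ} (ht : t < T) (x : EuclideanSpace ℝ (Fin 3)) :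
    F t x ≤ Cf * heatKernel (ν * (T - t) + 1) x := by
  have h := caloric_norm_heatExtension_le_heatKernel hCf (mul_pos hν (sub_pos.2 ht)) x
  rw [Real.norm_eq_abs] at h
  rw [hF]
  exact (le_abs_self _).trans h

/-- **Gaussian domination of the gradient**: if `‖Df‖ ≤ C′ G₁` then
`‖D(F t)(x)‖ ≤ C′ G_{ν(T−t)+1}(x)` for `t < T`. -/
theorem caloric_norm_fderiv_le_heatKernel (hν : 0 < ν) (hf : ContDiff ℝ 1 f)
    (hfc : HasCompactSupport f) (hF : F = fun t x => heatExtension f (ν * (T - t)) x) {Cg : ℝ}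
    (hCg : ∀ z, ‖fderiv ℝ f z‖ ≤ Cg * heatKernel 1 z) {t : ℝ} (ht : t < T)
    (x : EuclideanSpace ℝ (Fin 3)) :
    ‖fderiv ℝ (F t) x‖ ≤ Cg * heatKernel (ν * (T - t) + 1) x := by
  rw [caloric_fderiv_eq hf hfc hF t x]
  exact caloric_norm_heatExtension_le_heatKernel hCg (mul_pos hν (sub_pos.2 ht)) x

/-- On a time range `[ta, T)` the Gaussians `G_{ν(T−t)+1}` lie below ONE integrable Gaussian:
`G_{ν(T−t)+1}(x) ≤ K G_{ν(T−ta)+1}(x)` (`prekernel_heatKernel_le`, ages in `[1, ν(T−ta)+1]`). -/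
theorem caloric_heatKernel_le_fixed (hν : 0 < ν) {ta t : ℝ} (ht : t ∈ Ico ta T)
    (x : EuclideanSpace ℝ (Fin 3)) :
    heatKernel (ν * (T - t) + 1) x ≤
      (4 * π * 1) ^ (-(Module.finrank ℝ (EuclideanSpace ℝ (Fin 3)) : ℝ) / 2) /
        (4 * π * (ν * (T - ta) + 1)) ^ (-(Module.finrank ℝ (EuclideanSpace ℝ (Fin 3)) : ℝ) / 2) *
      heatKernel (ν * (T - ta) + 1) x := by
  have h1 : (1:ℝ) ≤ ν * (T - t) + 1 := by
    have := mul_nonneg hν.le (sub_nonneg.2 ht.2.le); linarith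
  have h2 : ν * (T - t) + 1 ≤ ν * (T - ta) + 1 := by
    have := mul_le_mul_of_nonneg_left (show T - t ≤ T - ta by linarith [ht.1]) hν.le; linarith
  exact prekernel_heatKernel_le one_pos h1 h2 x

/-- The Gaussian `G_{σ+1}` is uniformly small at spatial infinity for `σ` in a bounded range:
for `0 ≤ σ ≤ σ₁`, `G_{σ+1}(x) ≤ (4π)^{-3/2} e^{−‖x‖²/(4(σ₁+1))}`. -/
theorem caloric_heatKernel_succ_le {σ σ₁ : ℝ} (hσ : 0 ≤ σ) (hσ₁ : σ ≤ σ₁)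
    (x : EuclideanSpace ℝ (Fin 3)) :
    heatKernel (σ + 1) x ≤ (4 * π) ^ (-(3:ℝ) / 2) * Real.exp (-‖x‖ ^ 2 / (4 * (σ₁ + 1))) := by
  simp only [heatKernel, finrank_euclideanSpace_fin, Nat.cast_ofNat]
  have h1 : (4 * π * (σ + 1)) ^ (-(3:ℝ) / 2) ≤ (4 * π) ^ (-(3:ℝ) / 2) :=
    Real.rpow_le_rpow_of_nonpos (by positivity) (by nlinarith [Real.pi_pos]) (by norm_num)
  have h2 : Real.exp (-‖x‖ ^ 2 / (4 * (σ + 1))) ≤ Real.exp (-‖x‖ ^ 2 / (4 * (σ₁ + 1))) := by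
    rw [Real.exp_le_exp, neg_div, neg_div, neg_le_neg_iff]
    exact div_le_div_of_nonneg_left (sq_nonneg _) (by positivity) (by linarith)
  exact mul_le_mul h1 h2 (by positivity) (by positivity)

/-- **Uniform smallness of `F` at spatial infinity** on a bounded time range below `T`: for
`ta ≤ t < T` and every `δ > 0` there is `ρ₀` with `F(t, x) ≤ δ` whenever `‖x‖ ≥ ρ₀`. -/
theorem caloric_small_far (hν : 0 < ν)
    (hF : F = fun t x => heatExtension f (ν * (T - t)) x) {Cf : ℝ} (hCf0 : 0 ≤ Cf)
    (hCf : ∀ z, ‖f z‖ ≤ Cf * heatKernel 1 z) (ta : ℝ) {δ : ℝ} (hδ : 0 < δ) :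
    ∃ ρ₀ : ℝ, ∀ t ∈ Ico ta T, ∀ x : EuclideanSpace ℝ (Fin 3), ρ₀ ≤ ‖x‖ → F t x ≤ δ := by
  set σ₁ : ℝ := max (ν * (T - ta)) 0 with hσ₁
  set A : ℝ := Cf * (4 * π) ^ (-(3:ℝ) / 2) with hA
  have hA0 : 0 ≤ A := by rw [hA]; positivity
  -- Gaussian tail: choose `ρ₀` with `A e^{-ρ₀²/(4(σ₁+1))} ≤ δ`
  have hlim : Tendsto (fun ρ : ℝ => A * Real.exp (-ρ ^ 2 / (4 * (σ₁ + 1)))) atTop (𝓝 0) := by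
    have h2 : Tendsto (fun ρ : ℝ => Real.exp (-ρ ^ 2 / (4 * (σ₁ + 1)))) atTop (𝓝 0) := by
      refine Real.tendsto_exp_atBot.comp ?_
      have : Tendsto (fun ρ : ℝ => -ρ ^ 2 / (4 * (σ₁ + 1))) atTop atBot := by
        refine Tendsto.atBot_div_const (by positivity) ?_
        exact tendsto_neg_atTop_atBot.comp (tendsto_pow_atTop two_ne_zero)
      exact this
    simpa using h2.const_mul A
  obtain ⟨ρ₁, hρ₁⟩ := eventually_atTop.1 (Tendsto.eventually_le_const hδ hlim)
  refine ⟨max ρ₁ 0, fun t ht x hx => ?_⟩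
  have hσ : 0 ≤ ν * (T - t) := mul_nonneg hν.le (sub_nonneg.2 ht.2.le)
  have hσσ₁ : ν * (T - t) ≤ σ₁ :=
    (mul_le_mul_of_nonneg_left (by linarith [ht.1]) hν.le).trans (le_max_left _ _)
  have hm0 : 0 ≤ max ρ₁ 0 := le_max_right _ _
  calc F t x ≤ Cf * heatKernel (ν * (T - t) + 1) x := caloric_le_heatKernel hν hF hCf ht.2 x
    _ ≤ Cf * ((4 * π) ^ (-(3:ℝ) / 2) * Real.exp (-‖x‖ ^ 2 / (4 * (σ₁ + 1)))) :=
        mul_le_mul_of_nonneg_left (caloric_heatKernel_succ_le hσ hσσ₁ x) hCf0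
    _ = A * Real.exp (-‖x‖ ^ 2 / (4 * (σ₁ + 1))) := by rw [hA]; ring
    _ ≤ A * Real.exp (-(max ρ₁ 0) ^ 2 / (4 * (σ₁ + 1))) := by
        refine mul_le_mul_of_nonneg_left (Real.exp_le_exp.2 ?_) hA0
        rw [neg_div, neg_div, neg_le_neg_iff]
        exact div_le_div_of_nonneg_right (pow_le_pow_left₀ hm0 hx 2) (by positivity)
    _ ≤ δ := hρ₁ (max ρ₁ 0) (le_max_left _ _)

/-! ### Terminal attainment -/

/-- **Terminal attainment with a rate**: `|F(t, x) − f(x)| ≤ 3 C₂ ν (T − t)` for `t < T`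
(`‖e^{hΔ}k − k‖ ≤ d ‖D²k‖_∞ h`, the tree's `norm_heatExtension_sub_self_le_of_C2`). -/
theorem caloric_abs_sub_data_le (hν : 0 < ν) (hf : ContDiff ℝ 2 f)
    (hF : F = fun t x => heatExtension f (ν * (T - t)) x) {C₀ C₁ C₂ : ℝ}
    (hC₀ : ∀ z, ‖f z‖ ≤ C₀) (hC₁ : ∀ z, ‖fderiv ℝ f z‖ ≤ C₁)
    (hC₂ : ∀ z, ‖iteratedFDeriv ℝ 2 f z‖ ≤ C₂) {t : ℝ} (ht : t < T)
    (x : EuclideanSpace ℝ (Fin 3)) :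
    |F t x - f x| ≤ 3 * C₂ * (ν * (T - t)) := by
  have h := HeatHolder.norm_heatExtension_sub_self_le_of_C2 hf hC₀ hC₁ hC₂
    (mul_pos hν (sub_pos.2 ht)) x
  rw [finrank_euclideanSpace_fin, Nat.cast_ofNat, Real.norm_eq_abs] at h
  rw [hF]
  exact h

/-! ### The source `b·∇F` of the corrector equation -/

/-- **The weighted source is square integrable on a strip**: for `ta < Ta < T` and a jointly
continuous drift with `‖b‖ ≤ B`, the function `(t, x) ↦ (b·∇F)(t, x) e^{t}` lies in
`L²((ta, Ta) × ℝ³)` (it is continuous and dominated by a fixed Gaussian in `x`). -/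
theorem caloric_memLp_source (hν : 0 < ν) (hf : ContDiff ℝ 1 f) (hfc : HasCompactSupport f)
    (hF : F = fun t x => heatExtension f (ν * (T - t)) x) {ta Ta : ℝ} (hta : ta < Ta)
    (hTa : Ta < T) {b : ℝ → EuclideanSpace ℝ (Fin 3) → EuclideanSpace ℝ (Fin 3)} {B : ℝ}
    (hb : Continuous (uncurry b)) (hB : ∀ t x, ‖b t x‖ ≤ B) :
    MemLp (fun p : ℝ × EuclideanSpace ℝ (Fin 3) =>
        fderiv ℝ (F p.1) p.2 (b p.1 p.2) * Real.exp p.1) 2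
      (volume.restrict (Ioo ta Ta ×ˢ univ)) := by
  set S : Set (ℝ × EuclideanSpace ℝ (Fin 3)) := Ioo ta Ta ×ˢ univ with hS
  have hSm : MeasurableSet S := measurableSet_Ioo.prod MeasurableSet.univ
  have hSU : S ⊆ Iio T ×ˢ univ := prod_mono (fun t ht => lt_trans ht.2 hTa) Subset.rfl
  set μt : Measure ℝ := volume.restrict (Ioo ta Ta) with hμt
  haveI : IsFiniteMeasure μt := ⟨by
    rw [hμt, Measure.restrict_apply_univ]; exact measure_Ioo_lt_top⟩
  have hπ : (volume : Measure (ℝ × EuclideanSpace ℝ (Fin 3))).restrict S = μt.prod volume := by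
    rw [hμt, show (volume : Measure (ℝ × EuclideanSpace ℝ (Fin 3))) =
        (volume : Measure ℝ).prod (volume : Measure (EuclideanSpace ℝ (Fin 3))) from rfl, hS,
      ← Measure.prod_restrict, Measure.restrict_univ]
  have hB0 : 0 ≤ B := (norm_nonneg _).trans (hB ta 0)
  -- Gaussian domination of the gradient of the data
  obtain ⟨C₁, hC₁⟩ := (hf.continuous_fderiv one_ne_zero).bounded_above_of_compact_support
    (hfc.fderiv (𝕜 := ℝ))
  obtain ⟨Cg, hCg0, hCg⟩ := caloric_data_le_heatKernel (hfc.fderiv (𝕜 := ℝ)) hC₁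
  -- continuity on the strip
  have hF2 : ContDiffOn ℝ 2 (uncurry F) (Iio T ×ˢ univ) :=
    (caloric_isSmoothSpaceTimeOn hν hf.continuous hfc hF).of_le (by norm_cast)
  have hcD : ContinuousOn (fun p : ℝ × EuclideanSpace ℝ (Fin 3) => fderiv ℝ (F p.1) p.2) S :=
    (lowerOfUpper_continuousOn_fderiv_slice isOpen_Iio hF2).mono hSU
  have hcF : ContinuousOn (fun p : ℝ × EuclideanSpace ℝ (Fin 3) =>
      fderiv ℝ (F p.1) p.2 (b p.1 p.2) * Real.exp p.1) S :=
    (hcD.clm_apply hb.continuousOn).mul (Real.continuous_exp.comp continuous_fst).continuousOn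
  rw [memLp_two_iff_integrable_sq (hcF.aestronglyMeasurable hSm)]
  -- the Gaussian majorant
  have hσ₁ : 0 < ν * (T - ta) + 1 := by
    have := mul_pos hν (show 0 < T - ta by linarith); linarith
  set K : ℝ := (4 * π * 1) ^ (-(Module.finrank ℝ (EuclideanSpace ℝ (Fin 3)) : ℝ) / 2) /
    (4 * π * (ν * (T - ta) + 1)) ^ (-(Module.finrank ℝ (EuclideanSpace ℝ (Fin 3)) : ℝ) / 2) with hK
  have hK0 : 0 ≤ K := by
    rw [hK]
    exact div_nonneg (Real.rpow_nonneg (by positivity) _)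
      (Real.rpow_nonneg (by nlinarith [Real.pi_pos]) _)
  set M : ℝ := Cg * K * B * Real.exp Ta with hM
  have hM0 : 0 ≤ M := by rw [hM]; positivity
  have hG0 : ∀ y : EuclideanSpace ℝ (Fin 3), 0 ≤ heatKernel (ν * (T - ta) + 1) y := fun y =>
    (heatKernel_pos hσ₁ y).le
  set c₀ : ℝ := (4 * π * (ν * (T - ta) + 1)) ^ (-(Module.finrank ℝ (EuclideanSpace ℝ (Fin 3)) : ℝ) / 2)
    with hc₀
  have hg : Integrable (fun p : ℝ × EuclideanSpace ℝ (Fin 3) =>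
      M ^ 2 * c₀ * heatKernel (ν * (T - ta) + 1) p.2)
      ((volume : Measure (ℝ × EuclideanSpace ℝ (Fin 3))).restrict S) := by
    rw [hπ]
    exact (integrable_const (M ^ 2 * c₀)).mul_prod (integrable_heatKernel_holds hσ₁)
  refine hg.mono' ((hcF.pow 2).aestronglyMeasurable hSm) ?_
  rw [ae_restrict_iff' hSm]
  refine Eventually.of_forall fun p hp => ?_
  obtain ⟨t, x⟩ := p
  have ht : t ∈ Ioo ta Ta := hp.1
  have htT : t ∈ Ico ta T := ⟨ht.1.le, ht.2.trans hTa⟩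
  have h1 : |fderiv ℝ (F t) x (b t x) * Real.exp t| ≤ M * heatKernel (ν * (T - ta) + 1) x := by
    rw [abs_mul, abs_of_pos (Real.exp_pos t), hM]
    have h2 : |fderiv ℝ (F t) x (b t x)| ≤ Cg * K * heatKernel (ν * (T - ta) + 1) x * B := by
      rw [← Real.norm_eq_abs]
      refine (ContinuousLinearMap.le_opNorm _ _).trans ?_
      refine mul_le_mul ?_ (hB t x) (norm_nonneg _) (mul_nonneg (mul_nonneg hCg0 hK0) (hG0 x))
      calc ‖fderiv ℝ (F t) x‖ ≤ Cg * heatKernel (ν * (T - t) + 1) x :=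
            caloric_norm_fderiv_le_heatKernel hν hf hfc hF hCg htT.2 x
        _ ≤ Cg * (K * heatKernel (ν * (T - ta) + 1) x) :=
            mul_le_mul_of_nonneg_left (by rw [hK]; exact caloric_heatKernel_le_fixed hν htT x) hCg0
        _ = Cg * K * heatKernel (ν * (T - ta) + 1) x := by ring
    have h3 : Real.exp t ≤ Real.exp Ta := Real.exp_le_exp.2 ht.2.le
    calc |fderiv ℝ (F t) x (b t x)| * Real.exp t
        ≤ Cg * K * heatKernel (ν * (T - ta) + 1) x * B * Real.exp Ta :=
          mul_le_mul h2 h3 (Real.exp_pos t).le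
            (mul_nonneg (mul_nonneg (mul_nonneg hCg0 hK0) (hG0 x)) hB0)
      _ = Cg * K * B * Real.exp Ta * heatKernel (ν * (T - ta) + 1) x := by ring
  have hGc : heatKernel (ν * (T - ta) + 1) x ≤ c₀ := by rw [hc₀]; exact heatKernel_le hσ₁ x
  have h4 : (fderiv ℝ (F t) x (b t x) * Real.exp t) ^ 2 ≤
      (M * heatKernel (ν * (T - ta) + 1) x) ^ 2 := by
    rw [← sq_abs]
    exact pow_le_pow_left₀ (abs_nonneg _) h1 2
  rw [Real.norm_eq_abs, abs_of_nonneg (sq_nonneg _)]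
  calc (fderiv ℝ (F t) x (b t x) * Real.exp t) ^ 2
      ≤ (M * heatKernel (ν * (T - ta) + 1) x) ^ 2 := h4
    _ = M ^ 2 * heatKernel (ν * (T - ta) + 1) x * heatKernel (ν * (T - ta) + 1) x := by ring
    _ ≤ M ^ 2 * c₀ * heatKernel (ν * (T - ta) + 1) x := by
        refine mul_le_mul_of_nonneg_right ?_ (hG0 x)
        exact mul_le_mul_of_nonneg_left hGc (sq_nonneg _)

/-! ### Registered sub-goal -/

/-- **Registered sub-goal `stub_blockSolver_caloric`** (closed form of `caloric_memLp_source`,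
sub-goal of STUB `stub_blockSolver`): the weighted source `(b·∇F) eᵗ` of the corrector equation,
`F(t) = e^{ν(T−t)Δ}f`, is square integrable on every strip `(ta, Ta) × ℝ³` with `Ta < T`. -/
theorem stub_blockSolver_caloric :
    ∀ (ν T ta Ta B : ℝ) (f : (EuclideanSpace ℝ (Fin 3)) → ℝ) (b : ℝ → (EuclideanSpace ℝ (Fin 3)) → (EuclideanSpace ℝ (Fin 3))), 0 < ν → ta < Ta → Ta < T → ContDiff ℝ 1 f → HasCompactSupport f → Continuous (uncurry b) → (∀ t x, ‖b t x‖ ≤ B) → MemLp (fun p : ℝ × (EuclideanSpace ℝ (Fin 3)) => fderiv ℝ (fun x => Literature.Analysis.UnboundedOperators.heatExtension f (ν * (T - p.1)) x) p.2 (b p.1 p.2) * Real.exp p.1) 2 (volume.restrict (Ioo ta Ta ×ˢ univ)) :=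
  fun _ _ _ _ _ _ _ hν hta hTa hf hfc hb hB =>
    caloric_memLp_source hν hf hfc rfl hta hTa hb hB

end Summit.NavierStokesRegularity.NavierStokesRegularity.Theorems.AdaptedFrequencyConverges.CloudFrameEffectiveTsai

end
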